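import Summits.KontsevichZagierPeriods.KontsevichZagierPeriods.Theorems.HurwitzMicroSectorsNormalFormPrincipleDilogExistsBoxAtoms
import Summits.KontsevichZagierPeriods.KontsevichZagierPeriods.Theorems.HurwitzMicroSectorsNormalFormPrincipleDilogExistsSimplexPiecesOne
import Summits.KontsevichZagierPeriods.KontsevichZagierPeriods.Theorems.HurwitzMicroSectorsNormalFormPrincipleDilogExistsSimplexPiecesTwo
import Summits.KontsevichZagierPeriods.KontsevichZagierPeriods.Theorems.HurwitzMicroSectorsNormalFormPrincipleDilogZetaSimplexDissect
import Summits.KontsevichZagierPeriods.KontsevichZagierPeriods.Theorems.HurwitzMicroSectorsNormalFormPrincipleDilogBoxSubSimplex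
import Summits.KontsevichZagierPeriods.KontsevichZagierPeriods.Theorems.HurwitzMicroSectorsNormalFormPrincipleDilogUpperAndRect
import Summits.KontsevichZagierPeriods.KontsevichZagierPeriods.Theorems.HurwitzMicroSectorsNormalFormPrincipleDilogLandenMoebius
import Summits.KontsevichZagierPeriods.KontsevichZagierPeriods.Theorems.HurwitzMicroSectorsNormalFormPrincipleDilogSquareKit
import Summits.KontsevichZagierPeriods.KontsevichZagierPeriods.Theorems.HurwitzMicroSectorsNormalFormPrincipleDilogSquaresSubstitution

/-!
# `NormalFormPrinciple` (stmt-KontsevichZagierPeriods-3869), line `SketchIdeator1` —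
# leaf `stub_boxRigidity`: the DILOGARITHM LAYER (functional equations as move chains between box atoms)

Assembly file of the layer `Dilog` (lead seat c9; `--supports` the crux). The leaf `stub_boxRigidity`
(Conjecture 1 of Kontsevich–Zagier frozen to box-rational representations) predicts that every
`ℤ`-linear relation among the values of box-rational representations is a consequence of the moves.
The classical source of such relations in dimension two, off the cyclotomic families treated by seats
c3–c8, are the functional equations of the dilogarithm, read on the box atoms

* `D(a) = [(0,1)², 1/(a − x₀x₁)]`, `a ≥ 1` or `a < 0` real algebraic — value `Li₂(1/a)`
  (`D(1)` is Beukers' `ζ(2)` box), box-RATIONAL exactly when `a ∈ ℚ`;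
* `P(b,c) = [(0,1)², 1/((b + x₀)(c + x₁))]`, `b, c > 0` — value `log(1 + 1/b)·log(1 + 1/c)`.

This file proves, as honest chains of rules (1) (additivity) and (2) (change of variables) of the
tree's calculus (`Literature.NumberTheory.Transcendental.KZ.relations`), between representations that
are all shown to EXIST:

* `dilog_reflection` — Euler: `D(a) + D(a/(a−1)) + P(1/(a−1), a−1) ≡ D(1)` (`a > 1`);
* `dilog_landen` — Landen: `2D(a) + 2D(1−a) + P(a−1, a−1) ≡ 0` (`a > 1`);
* `dilog_duplication` — `D(a²) ≡ 2D(a) + 2D(−a)` (`|a| ≥ 1`);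

from the eight registered sub-goal files of the layer (`…DilogExistsBoxAtoms`, `…ExistsSimplexPiecesOne/Two`,
`…ZetaSimplexDissect`, `…BoxSubSimplex`, `…UpperAndRect`, `…LandenMoebius`, `…SquareKit`,
`…SquaresSubstitution`), and assembles the registered existence statement `exists_simplexPieces`.

NOVELTY / prior art. The same three functional equations are already chains of moves in the tree in
the SIMPLEX model `L(x) = [{0 < w₁ < w₀ < x}, 1/(w₀(1 − w₁))]` of route HyperbolicBloch
(`Theorems/HyperbolicBlochOffTetraSectorKernelStubEulerReflection/StubDilogLanden/StubDilogDuplication`,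
together with Abel's five-term relation `…StubAbelFiveTerm` and the golden-ratio evaluation
`…StubGoldenDilog`). What this layer adds is the transport to the BOX-RATIONAL atoms in the vocabulary
of `stub_boxRigidity` — the bridge `box_sub_simplex` (`D(a) ≡ L(1/a)`, including negative arguments
`{w < t₀ < t₁ < 0}`), the log-product boxes as the rectangles/squares of the dissections, the Möbius
involution form of Landen, and the existence of every representation involved — so that the
five-term relation and the ladder evaluations of that route become available on `(0,1)²` by one
move each. Sources: M. Kontsevich, D. Zagier, *Periods* (2001), §1.1–1.2; L. Lewin, *Polylogarithms
and associated functions* (1981), Ch. 1; D. Zagier, *The dilogarithm function* (2007), §I.2.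
No definitions are introduced.
-/

noncomputable section

open MeasureTheory Set
open Literature.NumberTheory.Transcendental Literature.NumberTheory.Transcendental.KZ
open Literature.ModelTheory.ExponentialFields (IsSemialgebraic)

namespace Summit.KontsevichZagierPeriods.HurwitzMicroSectors.NormalFormPrinciple.PiBox.Dilog

/-! ## The simplex pieces exist (registered sub-goal `exists_simplexPieces`, assembled) -/

/-- **Stub S1b (`exists_simplexPieces`; registered sub-goal of stmt-KontsevichZagierPeriods-3869, line
`SketchIdeator1`, layer `Dilog`), assembled from its two landed halves `exists_simplexPieces_one`
(pieces `A`, `A'`, `M`) and `exists_simplexPieces_two` (pieces `B`, `C`, `Q`, `R`).** For real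
algebraic parameters, the seven pieces of the `ζ(2)`-simplex calculus exist as integral
representations with literally the displayed domains and integrands: the lower triangle
`A(z) = [{0 < t₁ < t₀ < z}, 1/(t₀(1−t₁))]` (`0 < z ≤ 1`), the upper triangle `B(z)`, the rectangle
`C(z)`, the negative piece `A'(w) = [{w < t₀ < t₁ < 0}, 1/(t₀(1−t₁))]` (`w < 0`), the Möbius piece
`M(z)`, the triangle `Q(z)` and the square `R(z)` (`0 < z < 1`). [cite: KontsevichZagier2001, §1.1] -/
theorem exists_simplexPieces :
    (∀ z : ℝ, IsAlgebraic ℚ z → 0 < z → z ≤ 1 →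
      ∃ A : IntegralRep 2, A.domain = {t | 0 < t 1 ∧ t 1 < t 0 ∧ t 0 < z} ∧
        A.integrand = fun t => 1 / (t 0 * (1 - t 1))) ∧
    (∀ z : ℝ, IsAlgebraic ℚ z → 0 < z → z < 1 →
      ∃ B : IntegralRep 2, B.domain = {t | z < t 1 ∧ t 1 < t 0 ∧ t 0 < 1} ∧
        B.integrand = fun t => 1 / (t 0 * (1 - t 1))) ∧
    (∀ z : ℝ, IsAlgebraic ℚ z → 0 < z → z < 1 →
      ∃ C : IntegralRep 2, C.domain = {t | 0 < t 1 ∧ t 1 < z ∧ z < t 0 ∧ t 0 < 1} ∧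
        C.integrand = fun t => 1 / (t 0 * (1 - t 1))) ∧
    (∀ w : ℝ, IsAlgebraic ℚ w → w < 0 →
      ∃ A' : IntegralRep 2, A'.domain = {t | w < t 0 ∧ t 0 < t 1 ∧ t 1 < 0} ∧
        A'.integrand = fun t => 1 / (t 0 * (1 - t 1))) ∧
    (∀ z : ℝ, IsAlgebraic ℚ z → 0 < z → z < 1 →
      ∃ M : IntegralRep 2, M.domain = {t | 0 < t 1 ∧ t 1 < t 0 ∧ t 0 < z} ∧
        M.integrand = fun t => -1 / (t 0 * (1 - t 0) * (1 - t 1))) ∧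
    (∀ z : ℝ, IsAlgebraic ℚ z → 0 < z → z < 1 →
      ∃ Q : IntegralRep 2, Q.domain = {t | 0 < t 1 ∧ t 1 < t 0 ∧ t 0 < z} ∧
        Q.integrand = fun t => 1 / ((1 - t 0) * (1 - t 1))) ∧
    (∀ z : ℝ, IsAlgebraic ℚ z → 0 < z → z < 1 →
      ∃ R : IntegralRep 2, R.domain = {t | 0 < t 0 ∧ t 0 < z ∧ 0 < t 1 ∧ t 1 < z} ∧
        R.integrand = fun t => 1 / ((1 - t 0) * (1 - t 1))) :=
  ⟨exists_simplexPieces_one.1, exists_simplexPieces_two.1, exists_simplexPieces_two.2.1,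
    exists_simplexPieces_one.2.1, exists_simplexPieces_one.2.2, exists_simplexPieces_two.2.2.1,
    exists_simplexPieces_two.2.2.2⟩

/-! ## The functional equations -/

/-- **Euler's reflection formula as a chain of Kontsevich–Zagier moves between box atoms.** For real
algebraic `a > 1` and any representations `D₁ = [□, 1/(a − x₀x₁)]` (value `Li₂(1/a)`),
`D₂ = [□, 1/(a/(a−1) − x₀x₁)]` (value `Li₂(1 − 1/a)`), `P = [□, 1/((1/(a−1) + x₀)((a−1) + x₁))]`
(value `log(a)·log(a/(a−1))`) and `Z = [□, 1/(1 − x₀x₁)]` (Beukers' `ζ(2)` box) on the open unit box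
`□ = (0,1)²`: `[D₁] + [D₂] + [P] − [Z] ∈ KZ.relations` — i.e. `Li₂(z) + Li₂(1−z) + log z·log(1−z) = ζ(2)`
(`z = 1/a`) holds move-by-move, using rules (1) and (2) only: the three boxes are charted onto the
lower triangle, the (reflected) upper triangle and the rectangle of the scissors dissection of the
`ζ(2)`-simplex at `z` (`box_sub_simplex`, `upper_and_rect`, `zetaSimplex_dissect`). Prior art in the
tree: the same dissection in the simplex model is route HyperbolicBloch's
`OffTetraSectorKernel.stub_eulerReflection`; new here is the transport to the box-rational atoms of
`stub_boxRigidity` (for `a ∈ ℚ` all four representations are `IsRational` on `(0,1)²`).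
[cite: KontsevichZagier2001, §1.2 rules (1), (2)] -/
theorem dilog_reflection {a : ℝ} (ha : IsAlgebraic ℚ a) (ha1 : 1 < a)
    (D₁ D₂ P Z : IntegralRep 2)
    (hD₁d : D₁.domain = {x | ∀ i, x i ∈ Set.Ioo (0:ℝ) 1})
    (hD₁i : EqOn D₁.integrand (fun x => 1 / (a - x 0 * x 1)) D₁.domain)
    (hD₂d : D₂.domain = {x | ∀ i, x i ∈ Set.Ioo (0:ℝ) 1})
    (hD₂i : EqOn D₂.integrand (fun x => 1 / (a / (a - 1) - x 0 * x 1)) D₂.domain)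
    (hPd : P.domain = {x | ∀ i, x i ∈ Set.Ioo (0:ℝ) 1})
    (hPi : EqOn P.integrand (fun x => 1 / ((1 / (a - 1) + x 0) * ((a - 1) + x 1))) P.domain)
    (hZd : Z.domain = {x | ∀ i, x i ∈ Set.Ioo (0:ℝ) 1})
    (hZi : EqOn Z.integrand (fun x => 1 / (1 - x 0 * x 1)) Z.domain) :
    of D₁ + of D₂ + of P - of Z ∈ relations := by
  have ha0 : 0 < a := by linarith
  have ha1' : (0:ℝ) < a - 1 := by linarith
  set z : ℝ := 1 / a with hz
  have hz0 : 0 < z := by positivity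
  have hz1 : z < 1 := by rw [hz, div_lt_one ha0]; exact ha1
  have hzalg : IsAlgebraic ℚ z := by
    rw [hz, one_div]; exact ha.inv
  have haz : a * z = 1 := by rw [hz]; field_simp
  have h1z : IsAlgebraic ℚ (1 - z) := isAlgebraic_one.sub hzalg
  have hadiv : IsAlgebraic ℚ (a / (a - 1)) := by
    rw [div_eq_mul_inv]; exact ha.mul (ha.sub isAlgebraic_one).inv
  -- the pieces
  obtain ⟨hA, hB, hC, -, -, -, -⟩ := exists_simplexPieces
  obtain ⟨S, hSd, hSi⟩ := hA 1 isAlgebraic_one one_pos le_rfl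
  obtain ⟨A, hAd, hAi⟩ := hA z hzalg hz0 hz1.le
  obtain ⟨A', hA'd, hA'i⟩ := hA (1 - z) h1z (by linarith) (by linarith)
  obtain ⟨B, hBd, hBi⟩ := hB z hzalg hz0 hz1
  obtain ⟨C, hCd, hCi⟩ := hC z hzalg hz0 hz1
  -- the moves
  have e1 : of S - of A - of B - of C ∈ relations :=
    zetaSimplex_dissect hzalg hz0 hz1 S A B C hSd (hSi ▸ fun _ _ => rfl) hAd (hAi ▸ fun _ _ => rfl)
      hBd (hBi ▸ fun _ _ => rfl) hCd (hCi ▸ fun _ _ => rfl)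
  have e2 : of Z - of S ∈ relations :=
    box_sub_simplex.1 1 1 isAlgebraic_one le_rfl (by norm_num) Z S hZd hZi hSd (hSi ▸ fun _ _ => rfl)
  have e3 : of D₁ - of A ∈ relations :=
    box_sub_simplex.1 a z ha ha1.le haz D₁ A hD₁d hD₁i hAd (hAi ▸ fun _ _ => rfl)
  have haz' : a / (a - 1) * (1 - z) = 1 := by
    rw [hz]; field_simp
  have e4 : of D₂ - of A' ∈ relations :=
    box_sub_simplex.1 (a / (a - 1)) (1 - z) hadiv (by rw [le_div_iff₀ ha1']; linarith) haz' D₂ A' hD₂d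
      hD₂i hA'd (hA'i ▸ fun _ _ => rfl)
  have e5 : of B - of A' ∈ relations :=
    upper_and_rect.1 z hz0 hz1 B A' hBd (hBi ▸ fun _ _ => rfl) hA'd (hA'i ▸ fun _ _ => rfl)
  have e6 : of P - of C ∈ relations :=
    upper_and_rect.2 a z ha ha1 haz C P hCd (hCi ▸ fun _ _ => rfl) hPd hPi
  have e : of D₁ + of D₂ + of P - of Z =
      (of D₁ - of A) + (of D₂ - of A') + (of P - of C) - (of Z - of S)
        - (of S - of A - of B - of C) - (of B - of A') := by abel
  rw [e]
  exact relations.sub_mem (relations.sub_mem (relations.add_mem (relations.add_mem e3 e4) e6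
    |> fun h => relations.sub_mem h e2) e1) e5

/-- **Landen's identity as a chain of Kontsevich–Zagier moves between box atoms.** For real algebraic
`a > 1` and any representations `D₁ = [□, 1/(a − x₀x₁)]` (value `Li₂(1/a)`), `D₂ = [□, 1/((1−a) − x₀x₁)]`
(value `Li₂(1/(1−a))`) and `P = [□, 1/(((a−1) + x₀)((a−1) + x₁))]` (value `log²(a/(a−1))`) on the open
unit box: `2[D₁] + 2[D₂] + [P] ∈ KZ.relations` — i.e. `Li₂(z) + Li₂(z/(z−1)) = −½·log²(1−z)` (`z = 1/a`),
rules (1) and (2) only: both dilogarithm boxes are charted onto simplex pieces (`box_sub_simplex`, the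
second onto the negative piece `{w < t₀ < t₁ < 0}`), the Möbius involution `t ↦ t/(t−1)` on both
coordinates and one partial-fraction identity relate them to the symmetric square (`landen_moebius`,
`square_kit`), which is the log-product box. Prior art in the tree: route HyperbolicBloch's
`OffTetraSectorKernel.stub_dilogLanden` (simplex model, shear `1/(w₀(1+w₁))` instead of the Möbius
involution); new here is the box-atom form. [cite: KontsevichZagier2001, §1.2 rules (1), (2)] -/
theorem dilog_landen {a : ℝ} (ha : IsAlgebraic ℚ a) (ha1 : 1 < a)
    (D₁ D₂ P : IntegralRep 2)
    (hD₁d : D₁.domain = {x | ∀ i, x i ∈ Set.Ioo (0:ℝ) 1})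
    (hD₁i : EqOn D₁.integrand (fun x => 1 / (a - x 0 * x 1)) D₁.domain)
    (hD₂d : D₂.domain = {x | ∀ i, x i ∈ Set.Ioo (0:ℝ) 1})
    (hD₂i : EqOn D₂.integrand (fun x => 1 / ((1 - a) - x 0 * x 1)) D₂.domain)
    (hPd : P.domain = {x | ∀ i, x i ∈ Set.Ioo (0:ℝ) 1})
    (hPi : EqOn P.integrand (fun x => 1 / (((a - 1) + x 0) * ((a - 1) + x 1))) P.domain) :
    2 • of D₁ + 2 • of D₂ + of P ∈ relations := by
  have ha0 : 0 < a := by linarith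
  set z : ℝ := 1 / a with hz
  have hz0 : 0 < z := by positivity
  have hz1 : z < 1 := by rw [hz, div_lt_one ha0]; exact ha1
  have hzalg : IsAlgebraic ℚ z := by
    rw [hz, one_div]; exact ha.inv
  have haz : a * z = 1 := by rw [hz]; field_simp
  -- Landen's partner `w = z/(z-1) = 1/(1-a) < 0`
  set w : ℝ := 1 / (1 - a) with hw
  have hw0 : w < 0 := by rw [hw]; exact div_neg_of_pos_of_neg one_pos (by linarith)
  have hwalg : IsAlgebraic ℚ w := by
    rw [hw, one_div]
    exact (by simpa using (isAlgebraic_algebraMap (1:ℚ)).sub ha : IsAlgebraic ℚ (1 - a)).inv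
  have h1a : IsAlgebraic ℚ (1 - a) := isAlgebraic_one.sub ha
  have haw : (1 - a) * w = 1 := by
    rw [hw]; field_simp [(show (1:ℝ) - a ≠ 0 by linarith)]
  have hwz : w * (z - 1) = z := by
    rw [hw, hz]; field_simp [(show (1:ℝ) - a ≠ 0 by linarith)]
  -- the pieces
  obtain ⟨hA, -, -, hA', hM, hQ, hR⟩ := exists_simplexPieces
  obtain ⟨A, hAd, hAi⟩ := hA z hzalg hz0 hz1.le
  obtain ⟨A', hA'd, hA'i⟩ := hA' w hwalg hw0
  obtain ⟨M, hMd, hMi⟩ := hM z hzalg hz0 hz1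
  obtain ⟨Q, hQd, hQi⟩ := hQ z hzalg hz0 hz1
  obtain ⟨R, hRd, hRi⟩ := hR z hzalg hz0 hz1
  -- the moves
  have e1 : of D₁ - of A ∈ relations :=
    box_sub_simplex.1 a z ha ha1.le haz D₁ A hD₁d hD₁i hAd (hAi ▸ fun _ _ => rfl)
  have e2 : of D₂ - of A' ∈ relations :=
    box_sub_simplex.2 (1 - a) w h1a (by linarith) haw D₂ A' hD₂d hD₂i hA'd (hA'i ▸ fun _ _ => rfl)
  have e3 : of M - of A' ∈ relations :=
    landen_moebius.1 z w hz0 hz1 hwz M A' hMd (hMi ▸ fun _ _ => rfl) hA'd (hA'i ▸ fun _ _ => rfl)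
  have e4 : of M + of A + of Q ∈ relations :=
    landen_moebius.2 z hz0 hz1 M A Q hMd (hMi ▸ fun _ _ => rfl) hAd (hAi ▸ fun _ _ => rfl) hQd
      (hQi ▸ fun _ _ => rfl)
  have e5 : 2 • of Q - of R ∈ relations :=
    square_kit.1 z hzalg hz0 hz1 Q R hQd (hQi ▸ fun _ _ => rfl) hRd (hRi ▸ fun _ _ => rfl)
  have e6 : of P - of R ∈ relations :=
    square_kit.2 a z ha ha1 haz R P hRd (hRi ▸ fun _ _ => rfl) hPd hPi
  have e : 2 • of D₁ + 2 • of D₂ + of P =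
      2 • (of D₁ - of A) + 2 • (of D₂ - of A') + 2 • (of M + of A + of Q) - 2 • (of M - of A')
        - (2 • of Q - of R) + (of P - of R) := by
    simp only [smul_sub, smul_add]; abel
  rw [e]
  refine relations.add_mem (relations.sub_mem (relations.sub_mem (relations.add_mem
    (relations.add_mem (relations.nsmul_mem e1 2) (relations.nsmul_mem e2 2))
    (relations.nsmul_mem e4 2)) (relations.nsmul_mem e3 2)) e5) e6

/-- **The duplication formula as a chain of Kontsevich–Zagier moves between box atoms.** For real
algebraic `a` with `|a| ≥ 1` and any representations `D₂ = [□, 1/(a² − x₀x₁)]`, `D = [□, 1/(a − x₀x₁)]`,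
`D' = [□, 1/(−a − x₀x₁)]` on the open unit box: `[D₂] − 2[D] − 2[D'] ∈ KZ.relations` — i.e.
`Li₂(1/a²) = 2Li₂(1/a) + 2Li₂(−1/a)`, by the squares chart `(x₀,x₁) ↦ (x₀²,x₁²)` (rule 2) and partial
fractions (rule 1b) through the squares-substitution box `W(a)` (`exists_boxAtoms`,
`squares_substitution`). Prior art in the tree: route HyperbolicBloch's
`OffTetraSectorKernel.stub_dilogDuplication` (simplex model); new here is the box-atom form, valid
also for negative `a`. [cite: KontsevichZagier2001, §1.2 rules (1), (2)] -/
theorem dilog_duplication {a : ℝ} (ha : IsAlgebraic ℚ a) (ha1 : 1 ≤ |a|)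
    (D₂ D D' : IntegralRep 2)
    (hD₂d : D₂.domain = {x | ∀ i, x i ∈ Set.Ioo (0:ℝ) 1})
    (hD₂i : EqOn D₂.integrand (fun x => 1 / (a ^ 2 - x 0 * x 1)) D₂.domain)
    (hDd : D.domain = {x | ∀ i, x i ∈ Set.Ioo (0:ℝ) 1})
    (hDi : EqOn D.integrand (fun x => 1 / (a - x 0 * x 1)) D.domain)
    (hD'd : D'.domain = {x | ∀ i, x i ∈ Set.Ioo (0:ℝ) 1})
    (hD'i : EqOn D'.integrand (fun x => 1 / (-a - x 0 * x 1)) D'.domain) :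
    of D₂ - 2 • of D - 2 • of D' ∈ relations := by
  obtain ⟨-, -, hW⟩ := exists_boxAtoms
  obtain ⟨W, hWd, hWi⟩ := hW a ha ha1
  have e1 : of W - of D₂ ∈ relations :=
    squares_substitution.1 a D₂ W hD₂d hD₂i hWd (hWi ▸ fun _ _ => rfl)
  have e2 : of W - 2 • of D - 2 • of D' ∈ relations :=
    squares_substitution.2 a ha ha1 W D D' hWd (hWi ▸ fun _ _ => rfl) hDd hDi hD'd hD'i
  have e : of D₂ - 2 • of D - 2 • of D' = (of W - 2 • of D - 2 • of D') - (of W - of D₂) := by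
    abel
  rw [e]
  exact relations.sub_mem e2 e1

end Summit.KontsevichZagierPeriods.HurwitzMicroSectors.NormalFormPrinciple.PiBox.Dilog
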